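import Literature.Analysis.PDE.SobolevPairing
import Mathlib.MeasureTheory.Integral.IntervalIntegral.FundThmCalculus
import Mathlib.MeasureTheory.Integral.Prod
import Mathlib.MeasureTheory.Integral.DominatedConvergence
import Mathlib.Analysis.SpecialFunctions.Integrals.Basic
import Mathlib.Topology.Algebra.Order.Floor
import HarnessLib

/-!
# The energy identity and Grönwall: vanishing of solutions of a differential energy inequality

Abstract uniqueness engine of the energy-method programme for short-time existence of
quasilinear strictly parabolic second-order systems on a closed manifold (hypothesis `hQL` of
`Literature.Geometry.Riemannian.ricciFlow_shortTime_existence_of_quasilinear`). Both the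
uniqueness of classical solutions of the localised system across Sobolev levels and the
vanishing of the "non-geometric part" `Z = U - JGU` of the Kato–Lai solution are instances of
the following elementary fact (`eq_zero_of_energy_ineq`): let `D_k(t, y)`, `k < N`, be
`W`-valued fields on `[0, ε] × ℝⁿ` with `D_k(0, ·) = 0`, continuous in `y`, with time derivative
`G_k` within `[0, ε]` continuous in `t`, both uniformly in `L²(ℝⁿ)`; let `w_k` be bounded
continuous weights; if

`Σ_k ∫ w_k ⟪D_k(t), G_k(t)⟫ ≤ C Σ_k ∫ w_k ‖D_k(t)‖²` for every `t ∈ [0, ε]`,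

then `D ≡ 0`. Proof: `‖D_k(t, y)‖² = 2 ∫₀ᵗ ⟪D_k, G_k⟫` pointwise (fundamental theorem of
calculus), Fubini (the integrand is separately continuous, hence jointly measurable, and
dominated in `L¹(dy)` uniformly in time by Cauchy–Schwarz) gives the energy identity
`E(t) = 2 ∫₀ᵗ Σ_k ∫ w_k ⟪D_k, G_k⟫ ≤ 2C ∫₀ᵗ E`, and the integral form of Grönwall's lemma
(`eq_zero_of_le_integral`) gives `E ≡ 0`.
[cite: Evans2010, §7.1.2, Thm. 4 (uniqueness by the energy method); App. B.2 (Grönwall)]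

Everything is proved; no named fact and no `sorry` is introduced.

## References

* L. C. Evans, *Partial differential equations*, 2nd ed., AMS 2010, §7.1.2, App. B.2. [Evans2010]
-/

noncomputable section

open MeasureTheory Set Function Filter Metric intervalIntegral
open scoped ContDiff Topology RealInnerProductSpace ENNReal NNReal Interval

namespace Literature.Analysis.PDE

universe u

variable {ι : Type u} [Fintype ι]
variable {W : Type u} [NormedAddCommGroup W] [InnerProductSpace ℝ W] [CompleteSpace W]

omit [Fintype ι] [CompleteSpace W] in
/-- Inner products of `L²` functions are integrable. [folklore] -/
theorem integrable_realInner_of_memLp_two {α : Type*} [MeasurableSpace α] {μ : Measure α}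
    {f g : α → W} (hf : MemLp f 2 μ) (hg : MemLp g 2 μ) : Integrable (fun y => ⟪f y, g y⟫) μ := by
  have h := L2.integrable_inner (𝕜 := ℝ) (hf.toLp f) (hg.toLp g)
  refine h.congr ?_
  filter_upwards [hf.coeFn_toLp, hg.coeFn_toLp] with y hfy hgy
  rw [hfy, hgy]

/-! ### Grönwall in integral form -/

/-- **Grönwall's lemma, integral form, homogeneous case**: a continuous `f ≥ 0` on `[0, ε]`
with `f(t) ≤ A ∫₀ᵗ f` vanishes identically. [cite: Evans2010, App. B.2] -/
theorem eq_zero_of_le_integral {f : ℝ → ℝ} {ε A : ℝ} (hA : 0 ≤ A) (hf : ContinuousOn f (Icc 0 ε))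
    (hf0 : ∀ t ∈ Icc (0 : ℝ) ε, 0 ≤ f t)
    (hle : ∀ t ∈ Icc (0 : ℝ) ε, f t ≤ A * ∫ τ in (0 : ℝ)..t, f τ) :
    ∀ t ∈ Icc (0 : ℝ) ε, f t = 0 := by
  by_cases hε' : ε < 0
  · intro t ht; exact absurd (ht.1.trans ht.2) (not_le.2 hε')
  have hε : 0 ≤ ε := not_lt.1 hε'
  -- a bound `M` for `f` on the compact interval
  obtain ⟨M, hM⟩ := (isCompact_Icc (a := (0 : ℝ)) (b := ε)).exists_bound_of_continuousOn hf
  have hM0 : 0 ≤ M := (norm_nonneg _).trans (hM 0 ⟨le_rfl, hε⟩)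
  -- `f t ≤ M Aⁿ tⁿ / n!` by induction
  have hind : ∀ n : ℕ, ∀ t ∈ Icc (0 : ℝ) ε, f t ≤ M * (A ^ n * t ^ n / n.factorial) := by
    intro n
    induction n with
    | zero =>
      intro t ht
      have := hM t ht
      rw [Real.norm_eq_abs, abs_of_nonneg (hf0 t ht)] at this
      simpa using this
    | succ n ih =>
      intro t ht
      refine (hle t ht).trans ?_
      have hmono : ∫ τ in (0 : ℝ)..t, f τ ≤ ∫ τ in (0 : ℝ)..t, M * (A ^ n * τ ^ n / n.factorial) := by
        refine intervalIntegral.integral_mono_on ht.1 ?_ ?_ fun τ hτ => ih τ ⟨hτ.1, hτ.2.trans ht.2⟩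
        · exact (hf.mono (Icc_subset_Icc_right ht.2)).intervalIntegrable_of_Icc ht.1
        · exact (Continuous.continuousOn (by fun_prop)).intervalIntegrable_of_Icc ht.1
      have hcalc : ∫ τ in (0 : ℝ)..t, M * (A ^ n * τ ^ n / n.factorial) =
          M * (A ^ n * t ^ (n + 1) / ((n + 1) * n.factorial)) := by
        rw [intervalIntegral.integral_const_mul]
        have : ∫ τ in (0 : ℝ)..t, A ^ n * τ ^ n / n.factorial = A ^ n / n.factorial * ∫ τ in (0 : ℝ)..t, τ ^ n := by
          rw [← intervalIntegral.integral_const_mul]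
          refine intervalIntegral.integral_congr fun τ _ => ?_
          show A ^ n * τ ^ n / n.factorial = A ^ n / n.factorial * τ ^ n
          ring
        rw [this, integral_pow]
        simp only [zero_pow (Nat.succ_ne_zero n), sub_zero]
        field_simp
      rw [hcalc] at hmono
      calc A * ∫ τ in (0 : ℝ)..t, f τ ≤ A * (M * (A ^ n * t ^ (n + 1) / ((n + 1) * n.factorial))) :=
            mul_le_mul_of_nonneg_left hmono hA
        _ = M * (A ^ (n + 1) * t ^ (n + 1) / (n + 1).factorial) := by
            rw [Nat.factorial_succ]; push_cast; ring
  -- let `n → ∞`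
  intro t ht
  have hlim : Tendsto (fun n : ℕ => M * (A ^ n * t ^ n / n.factorial)) atTop (𝓝 (M * 0)) := by
    refine Tendsto.const_mul M ?_
    have h := FloorSemiring.tendsto_pow_div_factorial_atTop (A * t)
    refine h.congr fun n => ?_
    rw [mul_pow]
  rw [mul_zero] at hlim
  have hge : ∀ n : ℕ, f t ≤ M * (A ^ n * t ^ n / n.factorial) := fun n => hind n t ht
  have := ge_of_tendsto' hlim hge
  exact le_antisymm this (hf0 t ht)

/-! ### The pointwise energy identity -/

omit [CompleteSpace W] in
/-- **Pointwise energy identity**: `‖D(t)‖² = 2 ∫₀ᵗ ⟪D, G⟫` when `D(0) = 0` and `D' = G` within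
`[0, ε]`, `G` continuous. [cite: Evans2010, §7.1.2] -/
theorem norm_sq_eq_two_mul_integral {D G : ℝ → W} {ε : ℝ} (h0 : D 0 = 0)
    (hder : ∀ t ∈ Icc (0 : ℝ) ε, HasDerivWithinAt D (G t) (Icc 0 ε) t)
    (hG : ContinuousOn G (Icc 0 ε)) {t : ℝ} (ht : t ∈ Icc (0 : ℝ) ε) :
    ‖D t‖ ^ 2 = 2 * ∫ τ in (0 : ℝ)..t, ⟪D τ, G τ⟫ := by
  have hDc : ContinuousOn D (Icc 0 ε) := fun τ hτ => (hder τ hτ).continuousWithinAt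
  have hφ : ∀ τ ∈ Icc (0 : ℝ) ε, HasDerivWithinAt (fun σ => ⟪D σ, D σ⟫) (2 * ⟪D τ, G τ⟫) (Icc 0 ε) τ := by
    intro τ hτ
    have h := (hder τ hτ).inner ℝ (hder τ hτ)
    refine h.congr_deriv ?_
    rw [real_inner_comm (G τ), two_mul]
  have hcont : ContinuousOn (fun σ => ⟪D σ, D σ⟫) (Icc 0 t) :=
    ((hDc.mono (Icc_subset_Icc_right ht.2)).inner (hDc.mono (Icc_subset_Icc_right ht.2)))
  have hint : IntervalIntegrable (fun τ => 2 * ⟪D τ, G τ⟫) volume 0 t := by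
    refine ((continuousOn_const.mul ((hDc.inner hG).mono ?_))).intervalIntegrable
    rw [uIcc_of_le ht.1]; exact Icc_subset_Icc_right ht.2
  have hFTC := integral_eq_sub_of_hasDeriv_right_of_le ht.1 hcont (fun τ hτ => ?_) hint
  · rw [intervalIntegral.integral_const_mul] at hFTC
    rw [hFTC, h0, inner_zero_left, sub_zero, real_inner_self_eq_norm_sq]
  · have hτε : τ ∈ Icc (0 : ℝ) ε := ⟨hτ.1.le, hτ.2.le.trans ht.2⟩
    refine (hφ τ hτε).mono_of_mem_nhdsWithin ?_
    have hlt : τ < ε := hτ.2.trans_le ht.2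
    exact mem_of_superset (Ioc_mem_nhdsGT hlt) fun x hx => ⟨hτ.1.le.trans hx.1.le, hx.2⟩

/-! ### The energy identity in `L²` and the conclusion -/

section Energy

variable {N : ℕ} {ε : ℝ}
variable {D G : Fin N → ℝ → EuclideanSpace ℝ ι → W} {w : Fin N → EuclideanSpace ℝ ι → ℝ}

omit [CompleteSpace W] in
/-- Joint strong measurability of `w ⟪D, G⟫` on `[0, ε] × ℝⁿ` (separately continuous data,
time extended by `projIcc`). [folklore] -/
theorem stronglyMeasurable_energyIntegrand (hε : 0 ≤ ε) (k : Fin N) (hw : Continuous (w k))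
    (hder : ∀ y, ∀ t ∈ Icc (0 : ℝ) ε, HasDerivWithinAt (fun τ => D k τ y) (G k t y) (Icc 0 ε) t)
    (hGt : ∀ y, ContinuousOn (fun τ => G k τ y) (Icc 0 ε))
    (hDy : ∀ t ∈ Icc (0 : ℝ) ε, Continuous (D k t)) (hGy : ∀ t ∈ Icc (0 : ℝ) ε, Continuous (G k t)) :
    StronglyMeasurable (uncurry fun (τ : ℝ) (y : EuclideanSpace ℝ ι) =>
      w k y * ⟪D k (projIcc 0 ε hε τ) y, G k (projIcc 0 ε hε τ) y⟫) := by
  refine stronglyMeasurable_uncurry_of_continuous_of_stronglyMeasurable (fun y => ?_) fun τ => ?_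
  · have hD : ContinuousOn (fun τ => D k τ y) (Icc 0 ε) := fun τ hτ => (hder y τ hτ).continuousWithinAt
    have h : ContinuousOn (fun τ => w k y * ⟪D k τ y, G k τ y⟫) (Icc 0 ε) :=
      continuousOn_const.mul (hD.inner (hGt y))
    have e : (fun τ : ℝ => w k y * ⟪D k (projIcc 0 ε hε τ) y, G k (projIcc 0 ε hε τ) y⟫) =
        IccExtend hε (fun τ : Icc (0 : ℝ) ε => w k y * ⟪D k τ y, G k τ y⟫) := rfl
    rw [e]
    exact h.restrict.Icc_extend'
  · have hmem : (projIcc 0 ε hε τ : ℝ) ∈ Icc (0 : ℝ) ε := (projIcc 0 ε hε τ).2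
    exact (hw.mul ((hDy _ hmem).inner (hGy _ hmem))).stronglyMeasurable

omit [CompleteSpace W] in
/-- The `y`-sections `w ⟪D(t), G(t)⟫` are integrable with integral of norms `≤ wmax K²`.
[folklore] -/
theorem integrable_energySection (k : Fin N) {K wmax : ℝ} (hK : 0 ≤ K) (hw : Continuous (w k))
    (hw0 : ∀ y, 0 ≤ w k y) (hwmax : ∀ y, w k y ≤ wmax) {t : ℝ}
    (hDL : MemLp (D k t) 2 (volume : Measure (EuclideanSpace ℝ ι)) ∧
      (eLpNorm (D k t) 2 (volume : Measure (EuclideanSpace ℝ ι))).toReal ≤ K)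
    (hGL : MemLp (G k t) 2 (volume : Measure (EuclideanSpace ℝ ι)) ∧
      (eLpNorm (G k t) 2 (volume : Measure (EuclideanSpace ℝ ι))).toReal ≤ K) :
    Integrable (fun y => w k y * ⟪D k t y, G k t y⟫) (volume : Measure (EuclideanSpace ℝ ι)) ∧
      ∫ y, ‖w k y * ⟪D k t y, G k t y⟫‖ ≤ wmax * (K * K) := by
  have hIG := integrable_realInner_of_memLp_two hDL.1 hGL.1
  have hbdd : ∀ᵐ y ∂(volume : Measure (EuclideanSpace ℝ ι)), ‖w k y‖ ≤ wmax :=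
    Eventually.of_forall fun y => by rw [Real.norm_eq_abs, abs_of_nonneg (hw0 y)]; exact hwmax y
  have hint : Integrable (fun y => w k y * ⟪D k t y, G k t y⟫) (volume : Measure (EuclideanSpace ℝ ι)) :=
    hIG.bdd_mul hw.aestronglyMeasurable hbdd
  refine ⟨hint, ?_⟩
  -- `∫ ‖w ⟪D, G⟫‖ ≤ wmax ∫ ‖D‖ ‖G‖ ≤ wmax ‖D‖₂ ‖G‖₂`
  have hprod := integrable_realInner_of_memLp_two (W := ℝ) hDL.1.norm hGL.1.norm
  have hprod' : Integrable (fun y => ‖D k t y‖ * ‖G k t y‖) (volume : Measure (EuclideanSpace ℝ ι)) := by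
    refine hprod.congr (Eventually.of_forall fun y => ?_)
    change ⟪‖D k t y‖, ‖G k t y‖⟫ = ‖D k t y‖ * ‖G k t y‖
    rw [RCLike.inner_apply, RCLike.conj_to_real, mul_comm]
  have h1 : ∫ y, ‖w k y * ⟪D k t y, G k t y⟫‖ ≤ ∫ y, wmax * (‖D k t y‖ * ‖G k t y‖) := by
    refine integral_mono hint.norm (hprod'.const_mul wmax) fun y => ?_
    rw [norm_mul, Real.norm_eq_abs, abs_of_nonneg (hw0 y)]
    exact mul_le_mul (hwmax y) (norm_inner_le_norm _ _) (norm_nonneg _)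
      ((hw0 y).trans (hwmax y))
  have h2 : ∫ y, ‖D k t y‖ * ‖G k t y‖ ≤ K * K := by
    have h := abs_integral_inner_le_of_memLp (W := ℝ) hDL.1.norm hGL.1.norm
    rw [eLpNorm_norm, eLpNorm_norm] at h
    have e : ∫ y, ⟪‖D k t y‖, ‖G k t y‖⟫ = ∫ y, ‖D k t y‖ * ‖G k t y‖ :=
      integral_congr_ae (Eventually.of_forall fun y => by
        change ⟪‖D k t y‖, ‖G k t y‖⟫ = ‖D k t y‖ * ‖G k t y‖
        rw [RCLike.inner_apply, RCLike.conj_to_real, mul_comm])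
    rw [e] at h
    exact (le_abs_self _).trans (h.trans (mul_le_mul hDL.2 hGL.2 ENNReal.toReal_nonneg hK))
  have hwmax0 : 0 ≤ wmax := (hw0 0).trans (hwmax 0)
  calc _ ≤ ∫ y, wmax * (‖D k t y‖ * ‖G k t y‖) := h1
    _ = wmax * ∫ y, ‖D k t y‖ * ‖G k t y‖ := integral_const_mul _ _
    _ ≤ wmax * (K * K) := mul_le_mul_of_nonneg_left h2 hwmax0

omit [CompleteSpace W] in
/-- Integrability of `w ⟪D, G⟫` on the product `[0, t] × ℝⁿ`. [folklore] -/
theorem integrable_energyIntegrand_prod (hε : 0 ≤ ε) (k : Fin N) {K wmax : ℝ} (hK : 0 ≤ K)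
    (hw : Continuous (w k)) (hw0 : ∀ y, 0 ≤ w k y) (hwmax : ∀ y, w k y ≤ wmax)
    (hder : ∀ y, ∀ t ∈ Icc (0 : ℝ) ε, HasDerivWithinAt (fun τ => D k τ y) (G k t y) (Icc 0 ε) t)
    (hGt : ∀ y, ContinuousOn (fun τ => G k τ y) (Icc 0 ε))
    (hDy : ∀ t ∈ Icc (0 : ℝ) ε, Continuous (D k t)) (hGy : ∀ t ∈ Icc (0 : ℝ) ε, Continuous (G k t))
    (hDL : ∀ t ∈ Icc (0 : ℝ) ε, MemLp (D k t) 2 (volume : Measure (EuclideanSpace ℝ ι)) ∧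
      (eLpNorm (D k t) 2 (volume : Measure (EuclideanSpace ℝ ι))).toReal ≤ K)
    (hGL : ∀ t ∈ Icc (0 : ℝ) ε, MemLp (G k t) 2 (volume : Measure (EuclideanSpace ℝ ι)) ∧
      (eLpNorm (G k t) 2 (volume : Measure (EuclideanSpace ℝ ι))).toReal ≤ K)
    {t : ℝ} (ht : t ∈ Icc (0 : ℝ) ε) :
    Integrable (uncurry fun (τ : ℝ) (y : EuclideanSpace ℝ ι) => w k y * ⟪D k τ y, G k τ y⟫)
      (((volume : Measure ℝ).restrict (Ι (0 : ℝ) t)).prod (volume : Measure (EuclideanSpace ℝ ι))) := by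
  have hIoc : ∀ τ, τ ∈ Ι (0 : ℝ) t → τ ∈ Icc (0 : ℝ) ε := fun τ hτ => by
    rw [uIoc_of_le ht.1] at hτ; exact ⟨hτ.1.le, hτ.2.trans ht.2⟩
  have hae : ∀ᵐ z ∂(((volume : Measure ℝ).restrict (Ι (0 : ℝ) t)).prod (volume : Measure (EuclideanSpace ℝ ι))),
      z.1 ∈ Ι (0 : ℝ) t := by
    rw [Measure.restrict_prod_eq_prod_univ, ae_restrict_iff' (measurableSet_uIoc.prod MeasurableSet.univ)]
    exact Eventually.of_forall fun z hz => hz.1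
  have hsm := stronglyMeasurable_energyIntegrand hε k hw hder hGt hDy hGy
  have hmeas : AEStronglyMeasurable (uncurry fun (τ : ℝ) (y : EuclideanSpace ℝ ι) => w k y * ⟪D k τ y, G k τ y⟫)
      (((volume : Measure ℝ).restrict (Ι (0 : ℝ) t)).prod (volume : Measure (EuclideanSpace ℝ ι))) := by
    refine hsm.aestronglyMeasurable.congr ?_
    filter_upwards [hae] with z hz
    simp only [uncurry]
    rw [projIcc_of_mem hε (hIoc z.1 hz)]
  rw [integrable_prod_iff hmeas]
  constructor
  · refine (ae_restrict_iff' measurableSet_uIoc).2 (Eventually.of_forall fun τ hτ => ?_)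
    exact (integrable_energySection k hK hw hw0 hwmax (hDL τ (hIoc τ hτ)) (hGL τ (hIoc τ hτ))).1
  · refine Integrable.mono' (g := fun _ => wmax * (K * K))
      (integrableOn_const ((measure_mono uIoc_subset_uIcc).trans_lt isCompact_uIcc.measure_lt_top).ne)
      hmeas.norm.integral_prod_right' ?_
    refine (ae_restrict_iff' measurableSet_uIoc).2 (Eventually.of_forall fun τ hτ => ?_)
    rw [Real.norm_eq_abs, abs_of_nonneg (integral_nonneg fun y => norm_nonneg _)]
    exact (integrable_energySection k hK hw hw0 hwmax (hDL τ (hIoc τ hτ)) (hGL τ (hIoc τ hτ))).2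

omit [CompleteSpace W] in
/-- **The `L²` energy identity**:
`∫ w ‖D_k(t)‖² = 2 ∫₀ᵗ ∫ w ⟪D_k, G_k⟫ dy dτ`. [cite: Evans2010, §7.1.2] -/
theorem integral_energy_eq (hε : 0 ≤ ε) (k : Fin N) {K wmax : ℝ} (hK : 0 ≤ K)
    (hw : Continuous (w k)) (hw0 : ∀ y, 0 ≤ w k y) (hwmax : ∀ y, w k y ≤ wmax) (h0 : ∀ y, D k 0 y = 0)
    (hder : ∀ y, ∀ t ∈ Icc (0 : ℝ) ε, HasDerivWithinAt (fun τ => D k τ y) (G k t y) (Icc 0 ε) t)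
    (hGt : ∀ y, ContinuousOn (fun τ => G k τ y) (Icc 0 ε))
    (hDy : ∀ t ∈ Icc (0 : ℝ) ε, Continuous (D k t)) (hGy : ∀ t ∈ Icc (0 : ℝ) ε, Continuous (G k t))
    (hDL : ∀ t ∈ Icc (0 : ℝ) ε, MemLp (D k t) 2 (volume : Measure (EuclideanSpace ℝ ι)) ∧
      (eLpNorm (D k t) 2 (volume : Measure (EuclideanSpace ℝ ι))).toReal ≤ K)
    (hGL : ∀ t ∈ Icc (0 : ℝ) ε, MemLp (G k t) 2 (volume : Measure (EuclideanSpace ℝ ι)) ∧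
      (eLpNorm (G k t) 2 (volume : Measure (EuclideanSpace ℝ ι))).toReal ≤ K)
    {t : ℝ} (ht : t ∈ Icc (0 : ℝ) ε) :
    ∫ y, w k y * ‖D k t y‖ ^ 2 = 2 * ∫ τ in (0 : ℝ)..t, ∫ y, w k y * ⟪D k τ y, G k τ y⟫ := by
  have hpt : ∀ y, w k y * ‖D k t y‖ ^ 2 = 2 * ∫ τ in (0 : ℝ)..t, w k y * ⟪D k τ y, G k τ y⟫ := by
    intro y
    rw [norm_sq_eq_two_mul_integral (h0 y) (hder y) (hGt y) ht, intervalIntegral.integral_const_mul]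
    ring
  simp_rw [hpt]
  rw [MeasureTheory.integral_const_mul]
  congr 1
  exact (intervalIntegral_integral_swap (integrable_energyIntegrand_prod hε k hK hw hw0 hwmax hder hGt
    hDy hGy hDL hGL ht)).symm

omit [CompleteSpace W] in
/-- **Vanishing from the differential energy inequality** (see the module docstring).
[cite: Evans2010, §7.1.2, Thm. 4; App. B.2] -/
theorem eq_zero_of_energy_ineq (hε : 0 ≤ ε) {C K wmax : ℝ} (hC : 0 ≤ C) (hK : 0 ≤ K)
    (hw : ∀ k, Continuous (w k)) (hwpos : ∀ k y, 0 < w k y) (hwmax : ∀ k y, w k y ≤ wmax)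
    (h0 : ∀ k y, D k 0 y = 0)
    (hder : ∀ k y, ∀ t ∈ Icc (0 : ℝ) ε, HasDerivWithinAt (fun τ => D k τ y) (G k t y) (Icc 0 ε) t)
    (hGt : ∀ k y, ContinuousOn (fun τ => G k τ y) (Icc 0 ε))
    (hDy : ∀ k, ∀ t ∈ Icc (0 : ℝ) ε, Continuous (D k t))
    (hGy : ∀ k, ∀ t ∈ Icc (0 : ℝ) ε, Continuous (G k t))
    (hDL : ∀ k, ∀ t ∈ Icc (0 : ℝ) ε, MemLp (D k t) 2 (volume : Measure (EuclideanSpace ℝ ι)) ∧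
      (eLpNorm (D k t) 2 (volume : Measure (EuclideanSpace ℝ ι))).toReal ≤ K)
    (hGL : ∀ k, ∀ t ∈ Icc (0 : ℝ) ε, MemLp (G k t) 2 (volume : Measure (EuclideanSpace ℝ ι)) ∧
      (eLpNorm (G k t) 2 (volume : Measure (EuclideanSpace ℝ ι))).toReal ≤ K)
    (hineq : ∀ t ∈ Icc (0 : ℝ) ε, ∑ k, ∫ y, w k y * ⟪D k t y, G k t y⟫ ≤
      C * ∑ k, ∫ y, w k y * ‖D k t y‖ ^ 2) :
    ∀ (k : Fin N), ∀ t ∈ Icc (0 : ℝ) ε, ∀ y, D k t y = 0 := by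
  have hw0 : ∀ k y, 0 ≤ w k y := fun k y => (hwpos k y).le
  -- the energy `E` and the pairing `H`
  set E : ℝ → ℝ := fun t => ∑ k, ∫ y, w k y * ‖D k t y‖ ^ 2 with hE
  set H : ℝ → ℝ := fun τ => ∑ k, ∫ y, w k y * ⟪D k τ y, G k τ y⟫ with hH
  have hεmem : ε ∈ Icc (0 : ℝ) ε := ⟨hε, le_rfl⟩
  -- `H` is integrable on `[0, ε]`
  have hHint : IntegrableOn H (Icc 0 ε) (volume : Measure ℝ) := by
    have h1 : ∀ k, IntegrableOn (fun τ => ∫ y, w k y * ⟪D k τ y, G k τ y⟫) (Ι (0 : ℝ) ε) (volume : Measure ℝ) :=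
      fun k => (integrable_energyIntegrand_prod hε k hK (hw k) (hw0 k) (hwmax k) (hder k) (hGt k)
        (hDy k) (hGy k) (hDL k) (hGL k) hεmem).integral_prod_left
    have h2 : IntegrableOn H (Ι (0 : ℝ) ε) (volume : Measure ℝ) := by
      have := integrable_finsetSum (s := Finset.univ) fun k _ => h1 k
      exact this
    rw [uIoc_of_le hε] at h2
    exact (integrableOn_Icc_iff_integrableOn_Ioc (f := H) (μ := (volume : Measure ℝ)) (a := 0) (b := ε)).2 h2
  -- the identity `E t = 2 ∫₀ᵗ H`
  have hEH : ∀ t ∈ Icc (0 : ℝ) ε, E t = 2 * ∫ τ in (0 : ℝ)..t, H τ := by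
    intro t ht
    have hk : ∀ k, IntervalIntegrable (fun τ => ∫ y, w k y * ⟪D k τ y, G k τ y⟫) volume 0 t := fun k => by
      rw [intervalIntegrable_iff]
      exact (integrable_energyIntegrand_prod hε k hK (hw k) (hw0 k) (hwmax k) (hder k) (hGt k)
        (hDy k) (hGy k) (hDL k) (hGL k) ht).integral_prod_left
    simp only [hE, hH]
    rw [intervalIntegral.integral_finsetSum fun k _ => hk k, Finset.mul_sum]
    exact Finset.sum_congr rfl fun k _ => integral_energy_eq hε k hK (hw k) (hw0 k) (hwmax k) (h0 k)
      (hder k) (hGt k) (hDy k) (hGy k) (hDL k) (hGL k) ht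
  -- continuity and nonnegativity of `E`
  have hEcont : ContinuousOn E (Icc 0 ε) := by
    have h := continuousOn_primitive_interval (μ := (volume : Measure ℝ)) (f := H) (a := 0) (b := ε)
      (by rwa [uIcc_of_le hε])
    rw [uIcc_of_le hε] at h
    exact (continuousOn_const.mul h).congr fun t ht => hEH t ht
  have hE0 : ∀ t ∈ Icc (0 : ℝ) ε, 0 ≤ E t := fun t _ =>
    Finset.sum_nonneg fun k _ => integral_nonneg fun y => mul_nonneg (hw0 k y) (sq_nonneg _)
  -- Grönwall
  have hEle : ∀ t ∈ Icc (0 : ℝ) ε, E t ≤ (2 * C) * ∫ τ in (0 : ℝ)..t, E τ := by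
    intro t ht
    rw [hEH t ht, mul_assoc, ← intervalIntegral.integral_const_mul C]
    refine mul_le_mul_of_nonneg_left (intervalIntegral.integral_mono_on ht.1 ?_ ?_ fun τ hτ => ?_) zero_le_two
    · have h1 : IntegrableOn H (Icc 0 t) (volume : Measure ℝ) := hHint.mono_set (Icc_subset_Icc_right ht.2)
      exact (intervalIntegrable_iff_integrableOn_Icc_of_le ht.1).2 h1
    · exact ((continuousOn_const.mul hEcont).mono (Icc_subset_Icc_right ht.2)).intervalIntegrable_of_Icc ht.1
    · exact hineq τ ⟨hτ.1, hτ.2.trans ht.2⟩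
  have hEzero := eq_zero_of_le_integral (by positivity) hEcont hE0 hEle
  -- conclusion
  intro k t ht y
  have hsum : ∑ k', ∫ y, w k' y * ‖D k' t y‖ ^ 2 = 0 := hEzero t ht
  have hterm : ∫ y, w k y * ‖D k t y‖ ^ 2 = 0 :=
    (Finset.sum_eq_zero_iff_of_nonneg fun k' _ => integral_nonneg fun y =>
      mul_nonneg (hw0 k' y) (sq_nonneg _)).1 hsum k (Finset.mem_univ k)
  have hint : Integrable (fun y => w k y * ‖D k t y‖ ^ 2) (volume : Measure (EuclideanSpace ℝ ι)) := by
    have h1 : Integrable (fun y => ‖D k t y‖ ^ 2) (volume : Measure (EuclideanSpace ℝ ι)) :=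
      (memLp_two_iff_integrable_sq_norm (hDL k t ht).1.1).1 (hDL k t ht).1
    exact h1.bdd_mul (hw k).aestronglyMeasurable (Eventually.of_forall fun y => by
      rw [Real.norm_eq_abs, abs_of_nonneg (hw0 k y)]; exact hwmax k y)
  have hae : (fun y => w k y * ‖D k t y‖ ^ 2) =ᵐ[volume] 0 :=
    (integral_eq_zero_iff_of_nonneg (fun y => mul_nonneg (hw0 k y) (sq_nonneg _)) hint).1 hterm
  have hcont : Continuous fun y => w k y * ‖D k t y‖ ^ 2 := (hw k).mul ((hDy k t ht).norm.pow 2)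
  have hzero := congrFun ((hcont.ae_eq_iff_eq (volume : Measure (EuclideanSpace ℝ ι)) continuous_const).1 hae) y
  have h3 : w k y * ‖D k t y‖ ^ 2 = 0 := hzero
  rcases mul_eq_zero.1 h3 with h4 | h4
  · exact absurd h4 (hwpos k y).ne'
  · exact norm_eq_zero.1 (pow_eq_zero_iff two_ne_zero |>.1 h4)

end Energy

end Literature.Analysis.PDE

end
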